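import Literature.Analysis.ODE.OneBarrierKernelBound
import Literature.Analysis.ODE.ForbiddenHalfLineGrowth
import Literature.Analysis.ODE.TransitionZoneGrowth
import Literature.Geometry.Lorentzian.CarterThresholdBarrier
import Literature.Geometry.Lorentzian.TeukolskyRadialFluxKernel
import HarnessLib

/-!
# The threshold Green-kernel bound for Carter's equation across the Breitenlohner–Freedman barrier,
# given the barrier geometry and the far envelope (tortoise variable, explicit constant)
(namespace `Literature.Geometry.Lorentzian.Kerr`.)

Carter's radial equation `u″ + φu = 0`, `φ = ω² − V∘ρ` (`V = Kerr.sepPotential M a ω m Λ`, `ρ` a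
tortoise radius; DRSR arXiv:1402.7034 §5.2.3) AT THE SUPERRADIANT THRESHOLD `ω = mω₊ ≠ 0` in a
Breitenlohner–Freedman stable sector, where the forbidden set `{φ ≤ 0}` is a half-line `(−∞, b₂]`
(`CarterThresholdBarrier.forbidden_interval_threshold`). For the horizon-data solution `u_𝓗`
(`‖u_𝓗‖ → 1` at `−∞`, flux `Im(ū_𝓗 u_𝓗′) ≡ −(ω − mω₊) = 0`) and the infinity-data solution `u_𝓘`
(flux `Im(ū_𝓘 u_𝓘′) ≡ ω`), this file proves the two-point bound

  `‖u_𝓗 x‖·‖u_𝓘 x′‖ ≤ K·‖u_𝓗 u_𝓘′ − u_𝓘 u_𝓗′‖`  for all `x ≤ x′`, `s_θ ≤ x′`,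

GIVEN (as hypotheses, discharged elsewhere from the census and the threshold profile): the end `b₂` of
the forbidden half-line, a floor `q ≥ k₀²` (`q := V∘ρ − ω² = −φ`) on `[s_θ, b₂ − L]`, a deep stretch
`[s_lo, s_mid]` with `q ≥ k₁²`, a last layer `[b₂ − L, b₂]` with `|q| ≤ K_L²`, `K_L·L ≤ 1`, an envelope
`‖u_𝓘 s‖ ≤ P_I` for `s ≥ b₂` with `‖u_𝓘′ b₂‖ ≤ P_I′`, and the DEPTH
`8((P_I/L + P_I′)e)² ≤ k₁|ω| sinh(2k₁(s_mid − s_lo))`. The constant is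
`K = (25/7)(1 + k₀ℓ)/(k₀²ℓ) + ((P_I + L·P_I′)e)²/|ω| + 1/(2k₀)`, `ℓ = s_mid − s_lo`. Mechanism
(`Literature.Analysis.ODE.oneBarrier_kernel_le`):

* `threshold_pairing_le` — the ONE-SIDED flux pairing that survives at the threshold:
  `|ω|·‖u_𝓗 s‖ ≤ ‖u_𝓘 s‖·‖W‖` at every `s` (`Im(conj(u_𝓗u_𝓘)W) = ω‖u_𝓗‖²`);
* monotone outward growth of `u_𝓗` on the whole forbidden half-line
  (`ForbiddenHalfLineGrowth`: bounded at `−∞`, `q ≥ 0` on `(−∞, b₂]`);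
* the last layer by `TransitionZoneGrowth.norm_le_of_norm_coeff_le_sq` (factor `e`);
* `threshold_kernel_le_of_barrier` — the assembled bound.

No asymptotics, no special functions; the threshold cone kernel bound of the near-extremal Kerr
programme (crux `KappaExplicitWaveDecay`, BF-stable large-`Λ`) is this theorem plus geometry
(`CarterThresholdRate/TurningPoint(Tortoise)`, `CarterFarBarrierEnvelope`) and bookkeeping.

## References
* M. Dafermos, I. Rodnianski, Y. Shlapentokh-Rothman, arXiv:1402.7034 = Ann. of Math. 183 (2016),
  §§5.2.3, 6.3–6.4, 8 (key `DafermosRodnianskiShlapentokhrothman2014`).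
* R. Teixeira da Costa, Commun. Math. Phys. 378 (2020), Prop. 2.20 (fluxes of the normalised pair;
  key `Costa2019`). The assembly is folklore (Gelfand–Dikii diagonal kernel in one barrier).
-/

noncomputable section

open Filter Set Literature.Analysis.ODE
open scoped _root_.Topology _root_.ComplexConjugate

namespace Literature.Geometry.Lorentzian

namespace Kerr

section Threshold

variable {M a ω Λ : ℝ} {m : ℤ} {ρ : ℝ → ℝ} {uH uH₁ uI uI₁ : ℝ → ℂ}

/-- **The one-sided flux pairing at the threshold.** If `Im(ū u′) = 0` and `Im(v̄ v′) = ω` at a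
point, then `|ω|·‖u‖ ≤ ‖v‖·‖u v′ − v u′‖` (from `Im(conj(u v)(u v′ − v u′)) = ω‖u‖²`). [folklore] -/
theorem threshold_pairing_le {u u' v v' : ℂ} (hu : (conj u * u').im = 0) (hv : (conj v * v').im = ω) :
    |ω| * ‖u‖ ≤ ‖v‖ * ‖u * v' - v * u'‖ := by
  have hid := Costa2019.im_conj_mul_det u u' v v'
  rw [hu, hv, mul_zero, sub_zero] at hid
  have hle : |(conj (u * v) * (u * v' - v * u')).im| ≤ ‖conj (u * v) * (u * v' - v * u')‖ :=
    Complex.abs_im_le_norm _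
  rw [hid, norm_mul, Complex.norm_conj, norm_mul, abs_mul, abs_of_nonneg (sq_nonneg _)] at hle
  -- `‖u‖²|ω| ≤ ‖u‖‖v‖‖W‖`
  rcases (norm_nonneg u).eq_or_lt with h0 | hpos
  · rw [← h0, mul_zero]; positivity
  · have h2 : |ω| * ‖u‖ * ‖u‖ ≤ ‖v‖ * ‖u * v' - v * u'‖ * ‖u‖ := by nlinarith
    exact le_of_mul_le_mul_right h2 hpos

/-- **The threshold kernel bound across the barrier, given its geometry and the far envelope.** Let
`ρ` be a tortoise radius of a sub-extremal Kerr exterior and `ω = mω₊ ≠ 0`; let `u_𝓗`, `u_𝓘` solve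
Carter's equation with `‖u_𝓗‖ → 1` at `−∞`, horizon flux `−(ω − mω₊)` (`= 0`) and infinity flux `ω`.
Suppose `{s | ω² − V(ρ s) ≤ 0} = (−∞, b₂]`; points `s_θ ≤ s_lo < s_mid ≤ b₂ − L` (`L > 0`); floors
`V∘ρ − ω² ≥ k₀²` on `[s_θ, b₂ − L]`, `≥ k₁²` on `[s_lo, s_mid]` (`k₀, k₁ > 0`); the layer bound
`|V∘ρ − ω²| ≤ K_L²` on `[b₂ − L, b₂]` with `K_L L ≤ 1`; the envelope `‖u_𝓘 s‖ ≤ P_I` (`s ≥ b₂`),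
`‖u_𝓘′ b₂‖ ≤ P_I′`; and the depth `8((P_I/L + P_I′)e)² ≤ k₁|ω| sinh(2k₁(s_mid − s_lo))`. Then for all
`x ≤ x′` with `s_θ ≤ x′`:
`‖u_𝓗 x‖‖u_𝓘 x′‖ ≤ ((25/7)(1 + k₀ℓ)/(k₀²ℓ) + ((P_I + L P_I′)e)²/|ω| + 1/(2k₀))·‖u_𝓗 u_𝓘′ − u_𝓘 u_𝓗′‖(x)`,
`ℓ = s_mid − s_lo`. [folklore] -/
theorem threshold_kernel_le_of_barrier (hρ : IsTortoiseRadius M a ρ) (hMa : IsSubextremal M a)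
    (hσ : ω - m * horizonAngularVelocity M a = 0) (hω : ω ≠ 0)
    (hu : ∀ x, HasDerivAt uH (uH₁ x) x ∧
      HasDerivAt uH₁ (-(((ω ^ 2 - sepPotential M a ω m Λ (ρ x) : ℝ) : ℂ) * uH x)) x)
    (hv : ∀ x, HasDerivAt uI (uI₁ x) x ∧
      HasDerivAt uI₁ (-(((ω ^ 2 - sepPotential M a ω m Λ (ρ x) : ℝ) : ℂ) * uI x)) x)
    (hH0 : Tendsto (fun x ↦ ‖uH x‖) atBot (𝓝 1))
    (hHf : ∀ x, (starRingEnd ℂ (uH x) * uH₁ x).im = -(ω - m * horizonAngularVelocity M a))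
    (hIf : ∀ x, (starRingEnd ℂ (uI x) * uI₁ x).im = ω)
    {b₂ : ℝ} (hF : {s | ω ^ 2 - sepPotential M a ω m Λ (ρ s) ≤ 0} = Iic b₂)
    {sθ slo smid L k₀ k₁ KL PI PI' : ℝ} (hθlo : sθ ≤ slo) (hlomid : slo < smid)
    (hmidβ : smid ≤ b₂ - L) (hL : 0 < L)
    (hk₀ : 0 < k₀) (hqk₀ : ∀ s ∈ Icc sθ (b₂ - L), k₀ ^ 2 ≤ sepPotential M a ω m Λ (ρ s) - ω ^ 2)
    (hk₁ : 0 < k₁) (hqk₁ : ∀ s ∈ Icc slo smid, k₁ ^ 2 ≤ sepPotential M a ω m Λ (ρ s) - ω ^ 2)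
    (hKL : 0 ≤ KL) (hqL : ∀ s ∈ Icc (b₂ - L) b₂, |sepPotential M a ω m Λ (ρ s) - ω ^ 2| ≤ KL ^ 2)
    (hKLL : KL * L ≤ 1)
    (hPI : ∀ s, b₂ ≤ s → ‖uI s‖ ≤ PI) (hPI' : ‖uI₁ b₂‖ ≤ PI')
    (hdeep : 8 * ((PI / L + PI') * Real.exp 1) ^ 2 ≤
      k₁ * |ω| * Real.sinh (2 * (k₁ * (smid - slo))))
    {x x' : ℝ} (hxx' : x ≤ x') (hx' : sθ ≤ x') :
    ‖uH x‖ * ‖uI x'‖ ≤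
      (25 / 7 * ((1 + k₀ * (smid - slo)) / (k₀ ^ 2 * (smid - slo))) +
          ((PI + L * PI') * Real.exp 1) ^ 2 / |ω| + 1 / (2 * k₀)) *
        ‖uH x * uI₁ x - uI x * uH₁ x‖ := by
  have hM : 0 < M := hMa.pos
  set q : ℝ → ℝ := fun s ↦ sepPotential M a ω m Λ (ρ s) - ω ^ 2 with hqdef
  set β := b₂ - L with hβdef
  have hβb₂ : β ≤ b₂ := by rw [hβdef]; linarith
  -- the equation in the form `y″ = q y`
  have hu' : ∀ x, HasDerivAt uH (uH₁ x) x ∧ HasDerivAt uH₁ ((q x : ℂ) * uH x) x := fun x ↦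
    ⟨(hu x).1, (hu x).2.congr_deriv (by simp only [hqdef]; push_cast; ring)⟩
  have hv' : ∀ x, HasDerivAt uI (uI₁ x) x ∧ HasDerivAt uI₁ ((q x : ℂ) * uI x) x := fun x ↦
    ⟨(hv x).1, (hv x).2.congr_deriv (by simp only [hqdef]; push_cast; ring)⟩
  have hqc : Continuous q := by
    refine continuous_iff_continuousAt.2 fun s ↦ ?_
    have h := (hρ.hasDerivAt_omega_sq_sub_sepPotential hMa ω m Λ s).continuousAt.neg
    refine h.congr (Eventually.of_forall fun y ↦ ?_)
    simp only [hqdef, Pi.neg_apply]; ring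
  -- the Wronskian is constant
  set W := uH 0 * uI₁ 0 - uI 0 * uH₁ 0 with hWdef
  have hW : ∀ y, uH y * uI₁ y - uI y * uH₁ y = W := fun y ↦ wronskian_eq_of_global_sol hu' hv' y 0
  -- `q ≥ 0` on the forbidden half-line
  have hq0 : ∀ s ∈ Iic b₂, 0 ≤ q s := by
    intro s hs
    have : s ∈ {s | ω ^ 2 - sepPotential M a ω m Λ (ρ s) ≤ 0} := by rw [hF]; exact hs
    have h : ω ^ 2 - sepPotential M a ω m Λ (ρ s) ≤ 0 := this
    show 0 ≤ sepPotential M a ω m Λ (ρ s) - ω ^ 2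
    linarith
  -- the horizon flux vanishes at the threshold
  have hHf0 : ∀ s, (conj (uH s) * uH₁ s).im = 0 := fun s ↦ by rw [hHf s, hσ, neg_zero]
  -- monotone outward growth of `u_𝓗` on `(−∞, b₂]`
  have hbdd : IsBoundedUnder (· ≤ ·) atBot fun x ↦ ‖uH x‖ := hH0.isBoundedUnder_le
  have hmono : ∀ x y, x ≤ y → sθ ≤ y → y ≤ β → ‖uH x‖ ≤ 1 * ‖uH y‖ := fun x y hxy _ hy ↦ by
    rw [one_mul]
    exact norm_le_norm_of_isBoundedUnder (fun s hs ↦ hu' s) hq0 hbdd hxy (hy.trans hβb₂)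
  have hgrow : ∀ y ∈ Icc sθ slo, 0 ≤ (conj (uH y) * uH₁ y).re := fun y hy ↦
    re_conj_mul_deriv_nonneg_of_isBoundedUnder (fun s hs ↦ hu' s) hq0 hbdd y
      (mem_Iic.2 (hy.2.trans (hlomid.le.trans (hmidβ.trans hβb₂))))
  -- the one-sided pairing: `|ω|‖u_𝓗 s‖ ≤ ‖u_𝓘 s‖‖W‖`
  have hpair : ∀ s, |ω| * ‖uH s‖ ≤ ‖uI s‖ * ‖W‖ := fun s ↦ by
    rw [← hW s]; exact threshold_pairing_le (hHf0 s) (hIf s)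
  have hω0 : 0 < |ω| := abs_pos.2 hω
  have hW0 : 0 ≤ ‖W‖ := norm_nonneg _
  -- the last layer `[β, b₂] = [β, β + L]`
  have hPI0 : 0 ≤ PI := (norm_nonneg _).trans (hPI b₂ le_rfl)
  have hPI'0 : 0 ≤ PI' := (norm_nonneg _).trans hPI'
  set PA := (PI + L * PI') * Real.exp 1 with hPA
  set PA' := (PI / L + PI') * Real.exp 1 with hPA'
  have hPA0 : 0 ≤ PA := by positivity
  have hb₂β : b₂ = β + L := by rw [hβdef]; ring
  have hlayer : ∀ s ∈ Icc β b₂, ‖uI s‖ ≤ PA ∧ ‖uI₁ s‖ ≤ PA' := by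
    intro s hs
    have hs' : s ∈ Icc β (β + L) := by rw [← hb₂β]; exact hs
    have hb₂' : b₂ ∈ Icc β (β + L) := by rw [← hb₂β]; exact ⟨hβb₂, le_rfl⟩
    have hqL' : ∀ y ∈ Icc β (β + L), ‖((q y : ℝ) : ℂ)‖ ≤ KL ^ 2 := by
      intro y hy
      rw [← hb₂β] at hy
      rw [Complex.norm_real, Real.norm_eq_abs]
      exact hqL y hy
    obtain ⟨h1, h2⟩ := norm_le_of_norm_coeff_le_sq hL hKL (fun y _ ↦ hv' y) hqL' hb₂' hs'
    have hmax : max (KL * L) 1 = 1 := max_eq_right hKLL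
    have hKLi : KL ≤ L⁻¹ := by rw [inv_eq_one_div, le_div_iff₀ hL]; exact hKLL
    have hmax' : max KL L⁻¹ = L⁻¹ := max_eq_right hKLi
    rw [hmax] at h1 h2
    rw [hmax'] at h2
    have hvb : ‖uI b₂‖ ≤ PI := hPI b₂ le_rfl
    have he : 0 ≤ Real.exp 1 := (Real.exp_pos 1).le
    constructor
    · refine h1.trans (mul_le_mul_of_nonneg_right ?_ he)
      exact add_le_add hvb (mul_le_mul_of_nonneg_left hPI' hL.le)
    · refine h2.trans (mul_le_mul_of_nonneg_right ?_ he)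
      have : L⁻¹ * ‖uI b₂‖ ≤ PI / L := by
        rw [div_eq_inv_mul]; exact mul_le_mul_of_nonneg_left hvb (inv_pos.2 hL).le
      exact add_le_add this hPI'
  have hβmem : β ∈ Icc β b₂ := ⟨le_rfl, hβb₂⟩
  have hP₁ : ‖uI₁ β‖ ≤ PA' := (hlayer β hβmem).2
  -- envelope of `u_𝓘` beyond `β`, and `P_I ≤ P_A`
  have hPIA : PI ≤ PA := by
    rw [hPA]
    have h1 : PI ≤ PI + L * PI' := le_add_of_nonneg_right (by positivity)
    have h2 : PI + L * PI' ≤ (PI + L * PI') * Real.exp 1 :=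
      le_mul_of_one_le_right (by positivity) (by have := Real.add_one_le_exp (1:ℝ); linarith)
    exact h1.trans h2
  have hvenv : ∀ s, β ≤ s → ‖uI s‖ ≤ PA := by
    intro s hs
    rcases le_or_gt s b₂ with h | h
    · exact (hlayer s ⟨hs, h⟩).1
    · exact (hPI s h.le).trans hPIA
  -- `‖u_𝓗 x‖ ≤ P_A‖W‖/|ω|` for `x ≤ x′`, `β ≤ x′`
  have huenv : ∀ x x', x ≤ x' → β ≤ x' → ‖uH x‖ ≤ PA * ‖W‖ / |ω| := by
    intro x x' hxx' hx'
    rw [le_div_iff₀ hω0, mul_comm]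
    rcases le_or_gt x b₂ with h | h
    · -- compare with the point `t = min x′ b₂ ∈ [β, b₂]`
      set t := min x' b₂ with ht
      have hxt : x ≤ t := le_min hxx' h
      have htb : t ≤ b₂ := min_le_right _ _
      have hβt : β ≤ t := le_min hx' hβb₂
      have hm : ‖uH x‖ ≤ ‖uH t‖ := norm_le_norm_of_isBoundedUnder (fun s _ ↦ hu' s) hq0 hbdd hxt htb
      calc |ω| * ‖uH x‖ ≤ |ω| * ‖uH t‖ := mul_le_mul_of_nonneg_left hm hω0.le
        _ ≤ ‖uI t‖ * ‖W‖ := hpair t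
        _ ≤ PA * ‖W‖ := mul_le_mul_of_nonneg_right (hvenv t hβt) hW0
    · calc |ω| * ‖uH x‖ ≤ ‖uI x‖ * ‖W‖ := hpair x
        _ ≤ PA * ‖W‖ := mul_le_mul_of_nonneg_right (hvenv x (hβb₂.trans h.le)) hW0
  have hKA : 0 ≤ PA ^ 2 / |ω| := by positivity
  have hfar : ∀ x x', x ≤ x' → β ≤ x' → ‖uH x‖ * ‖uI x'‖ ≤ PA ^ 2 / |ω| * ‖W‖ := by
    intro x x' hxx' hx'
    calc ‖uH x‖ * ‖uI x'‖ ≤ PA * ‖W‖ / |ω| * PA :=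
          mul_le_mul (huenv x x' hxx' hx') (hvenv x' hx') (norm_nonneg _) (by positivity)
      _ = PA ^ 2 / |ω| * ‖W‖ := by ring
  -- the generic one-barrier bound
  have key := oneBarrier_kernel_le hqc hu' hv' hW hθlo hlomid hmidβ hk₀ hqk₀ hk₁ hqk₁ (hIf β) hP₁
    hdeep le_rfl hmono hgrow hKA hfar hxx' hx'
  rw [← hW x] at key
  simpa only [one_mul] using key

end Threshold

end Kerr

end Literature.Geometry.Lorentzian

end
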